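import Literature.IUT.HodgeArakelov.LabelClassesOfCuspsR3
import Literature.IUT.HodgeArakelov.DihedralCuspToy
import Literature.IUT.HodgeArakelov.CyclicToyEtaleThetaData
import Literature.IUT.HodgeArakelov.LabelledDecompositionNonVacuity
import HarnessLib

/-!
# [IUTchII] Cor. 2.4 (i): the repaired decl of record `Cor24_i' Dec W C Ld I` is STILL a SCHEMA —
# universal-closure certificate at the dihedral cusp toy (proof-only; FACT-LIST row F-2679)

S. Mochizuki, *Inter-universal Teichmüller theory II*, kurims manuscript (Dec. 2020), §2, Corollary 2.4 (i)
pp. 69–70: "Let `I_t ⊆ Π_v` be a cuspidal inertia group that belongs to the class determined by `t` such that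
`I_t ⊆ Δ_{v□}`. … Then for `γ, γ' ∈ Δ̂^±_v`, the following three conditions are equivalent: (a) `γ' ∈ Δ^±_{v□}`;
(b) `I^{γ·γ'}_t ⊆ Π^γ_{v□}`; (c) `I^{γ·γ'}_t ⊆ (Π^±_{v□})^γ`" [claim: Mochizuki2012, status: disputed]
(IUTchII §2 Cor 2.4 (i), kurims pp.69-70).  abc-iut cell, block F (FACT-proving wave, D-0078 rung A2.C), seat
abc-iut-f-130 (gen 8), FACT-LIST row **F-2679** `Cor24_i'` (label «conditional», LF-KERNEL-STATUS 2026-08-27T05:18Z: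
LABEL-OPEN, no deciding kernel event).  PROOF-ONLY companion of abc-iut-w4-d012's repair file of record
`LabelClassesOfCuspsR3.lean` (`Cor24_family`, `Cor24_i'`) over abc-iut-w5-d243's DIHEDRAL CUSP TOY
(`DihedralCuspToy.lean`) and CYCLIC-TOY étale-theta data (`CyclicToyEtaleThetaData.lean`); no `def`, no
`instance`, nothing re-typed; every decl of record is IMPORTED.

WHAT THE REPAIR FIXED AND WHAT IT DID NOT.  abc-iut-w4-d007's certificate `not_forall_cor24_i`
(`LabelClassesOfCuspsCor24iSchemaCertificate.lean`) refuted the universal closure of the frozen `Cor24_i W C H I`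
(F-1949) by two degenerations: a vacuous inertia predicate (`I := 1` counts as cuspidal) and a tower with
`Δ̂^±_v ⊄ Π^±_v`.  The repair `Cor24_i'` pins the printed family `Π_{v□} ∈ {Π_{v▶}, Π_{v•t}}` (`Cor24_family`) and —
through its parameter `L : LabCuspStructure C` (`LabCusp^±(Π_v) ≃ 𝔽_l`) — EXCLUDES the vacuous-inertia toy (over
the cyclic toy `Π_v = 1`, so `LabCuspStructure` is empty, abc-iut-w5-d028).  It does NOT exclude the second
degeneration: the interface record `PlusMinusTower` carries `Π^±_v ↪ Π̂^±_v` as an arbitrary injection, and in the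
typed condition (b) "`I^{γγ'} ⊆ Π^γ_{v□}`" the right-hand side is the image of the (tempered) `Π_{v□}`, whereas
`γ, γ'` range over the (profinite) `Δ̂^±_v`.  At the DIHEDRAL CUSP TOY — `Π_v = Π^±_v = D_{27} × 1`,
`Π̂^±_v = D_{27} × (0 × 0 × ℤ/3)`, `G_v = 1`, cusps `K_{3^t} × 1` (`t ∈ ℤ/3`), `LabCuspStructure` INHABITED
(`DihedralCuspToy.nonempty_labCuspStructure`) — take the subgraph decomposition `Π_{v•} = Π_{v▶} := ⊤ = Π_v`
(admissible: every `SubgraphDecomposition` axiom holds with `ι := id`), `H := Π_{v▶}` (first member of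
`Cor24_family`), `I := K_1 × 1`, `γ := 1`, `γ' := (1, (0,0,1)) ∈ Δ̂^±_v ∖ Π^±_v`: the direct-product conjugation by
`γ'` fixes `I ⊆ Π_v × 1`, so (b) holds, while (a) reads `γ' ∈ Δ^±_{v▶} ⊆ Π^±_v = D_{27} × 1`, false.

* `DihedralCuspToy.not_cor24_i_top_cusp_zero` — `¬ Cor24_i (dTower) (dCusps) ⊤ (K_1 × 1)` for every odd prime `l`;
* `DihedralCuspToy.exists_not_cor24_i'` — over the dihedral tower there are étale-theta data, a subgraph
  decomposition with `Π_{v▶} = ⊤`, a label structure and a labelled decomposition at which `Cor24_i'` FAILS for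
  `I := K_1 × 1`;
* **`not_forall_cor24_i'`** — the CLOSED certificate at universe `0` (`l := 3`, `p := 5`): the universal closure
  of F-2679 is FALSE.  The row is consumable only in instance form at genuine data — the seventeen conditional
  closers of the census (`cor24_i'_of_inputs`, `cor24_i'_of_inputs_inc`, `cor24_i'_of_graphLevels_byName`,
  `cor24_i'_of_agreements_of_equiv_zHat`, …) BY NAME — FACT-LIST class «universal-closure REFUTED / schema;
  instance forms open or model-witnessed».

HONEST FRAMING: a refuted universal closure is a statement about OUR typing (the interface records admit a finite
"tempered" group strictly inside its "profinite completion", with all decomposition groups normal), not about the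
printed corollary (there `Π̂^±_v` IS the profinite completion of `Π^±_v` and [IUTchI] Cor. 2.5 separates tempered
conjugates); the [IUTchII] claim key `Mochizuki2012` is DISPUTED (D-0012) and nothing of it is asserted; no side
is taken on [IUTchIII] Cor. 3.12; typed ≠ proved; nothing here asserts abc proved or refuted.
-/

noncomputable section

namespace Literature.IUT.HodgeArakelov

namespace DihedralCuspToy

open CyclicToy

variable (l p : ℕ) (hl : l.Prime) (hl2 : l ≠ 2) (hp : p.Prime) (hp2 : p ≠ 2) (hpl : p ≠ l)

include hl in
/-- The element `(1, (0,0,1)) ∈ Π̂^±_v = D_m × (0×0×ℤ/l)` of the dihedral cusp toy lies OUTSIDE `Π^±_v = D_m × 1`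
(`l` prime, so `1 ≠ 0` in `ℤ/l`). [claim: Mochizuki2012, status: disputed] (IUTchII §2 Def 2.3 (i), kurims p.67) -/
theorem ιpm_one_ne_one : ιpm l (Multiplicative.ofAdd 1) ≠ 1 := by
  haveI : Fact (1 < l) := ⟨hl.one_lt⟩
  intro h
  have h' : (Multiplicative.ofAdd (1 : ZMod l)) = 1 :=
    ιpm_injective l (by rw [h, map_one])
  exact one_ne_zero (Multiplicative.ofAdd.injective h' : (1 : ZMod l) = 0)

/-- **IUTchII:Cor2.4(i) FAILS at the dihedral cusp toy for `Π_{v□} := Π_v` and `I := K_1 × 1`** (kurims pp.69-70):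
with `γ := 1` and `γ' := (1,(0,0,1)) ∈ Δ̂^±_v ∖ Π^±_v`, condition (b) `I^{γγ'} ⊆ Π^γ_{v□}` holds (the second factor
of `Π̂^cor_v = D_m × (ℤ/2×ℤ/l×ℤ/l)` is abelian and `I ⊆ D_m × 1`), while (a) `γ' ∈ Δ^±_{v□} ⊆ Π^±_v = D_m × 1`
fails. [claim: Mochizuki2012, status: disputed] (IUTchII §2 Cor 2.4 (i), kurims pp.69-70) -/
theorem not_cor24_i_top_cusp_zero :
    ¬ Cor24_i (dTower l p hl hl2 hp hp2 hpl) (dCusps l p hl hl2 hp hp2 hpl) ⊤ (cusp l 0) := by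
  set W := dTower l p hl hl2 hp hp2 hpl with hW
  intro h
  -- `I := K_1 × 1` is a cuspidal inertia subgroup of `Π_v`
  have hI : (dCusps l p hl hl2 hp hp2 hpl).IsCuspidalInertia W.piV (cusp l 0) :=
    ⟨cusp_le_piV l p hl hl2 hp hp2 hpl 0, 0, rfl⟩
  -- `Π_{v□} := ⊤`, so `Π_{v□}` (inside `Π̂^cor_v`) is `Π_v` and `Δ_{v□} = Π_v` (`G_v = 1`)
  have hbox : W.box ⊤ = W.piV := (MonoidHom.range_eq_map _).symm
  have hker : W.aug.ker = ⊤ := MonoidHom.ker_one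
  have hIΔ : cusp l 0 ≤ W.deltaBox ⊤ := by
    refine le_inf ?_ ?_
    · rw [hbox]
      exact cusp_le_piV l p hl hl2 hp hp2 hpl 0
    · rw [hker]
      exact le_top
  -- `γ' := (1, (0,0,1)) ∈ Δ̂^±_v`
  set z : Amb l := ιpm l (Multiplicative.ofAdd 1) with hz
  have hzmem : z ∈ Hpm l := ⟨_, rfl⟩
  have hγ' : ((1, z) : Cor l) ∈ W.pmHat ⊓ W.aug.ker := by
    refine Subgroup.mem_inf.mpr ⟨Subgroup.mem_prod.mpr ⟨Subgroup.mem_top _, hzmem⟩, ?_⟩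
    rw [hker]
    exact Subgroup.mem_top _
  have hγ : (1 : Cor l) ∈ W.pmHat ⊓ W.aug.ker := Subgroup.one_mem _
  obtain ⟨h1, -⟩ := h hI hIΔ 1 (1, z) hγ hγ'
  -- condition (b): `I^{γ'} ⊆ Π_{v□}` — conjugation by `γ'` fixes `I ⊆ D_m × 1` pointwise
  have hb : (cusp l 0).map (MulAut.conj ((1 : Cor l) * (1, z))).toMonoidHom ≤
      (W.box ⊤).map (MulAut.conj (1 : Cor l)).toMonoidHom := by
    rintro _ ⟨y, hy, rfl⟩
    have hy2 : y.2 = 1 := (Subgroup.mem_prod.mp hy).2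
    have hfix : (MulAut.conj ((1 : Cor l) * (1, z))).toMonoidHom y = y := by
      rw [one_mul, MulEquiv.coe_toMonoidHom, MulAut.conj_apply]
      refine Prod.ext ?_ ?_
      · simp
      · show z * y.2 * z⁻¹ = y.2
        rw [hy2, mul_one, mul_inv_cancel]
    rw [hfix]
    refine ⟨y, ?_, ?_⟩
    · rw [hbox]
      exact cusp_le_piV l p hl hl2 hp hp2 hpl 0 hy
    · rw [map_one, MulEquiv.coe_toMonoidHom]
      rfl
  -- hence (a): `γ' ∈ Δ^±_{v□} ⊆ Π^±_v = D_m × 1`, i.e. `z = 1` — contradiction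
  have ha : ((1, z) : Cor l) ∈ W.deltaPmBox ⊤ := h1.mpr hb
  have hpm : ((1, z) : Cor l) ∈ W.piPM := (Subgroup.map_subtype_le _) (Subgroup.mem_inf.mp ha).1
  exact ιpm_one_ne_one l hl ((mem_piPM_iff l p hl hl2 hp hp2 hpl).mp hpm)

/-- **IUTchII:Cor2.4(i)′ FAILS over the dihedral cusp toy** (kurims pp.69-70): with the degenerate étale-theta data
of `CyclicToyEtaleThetaData` at the toy setting, the subgraph decomposition `Π_{v•} = Π_{v▶} := Π_v` (`ι := id`,
references `⊤`), ANY label structure `L` (inhabited: `nonempty_labCuspStructure`) and the labelled decomposition of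
`LabelledDecomposition.nonempty`, the repaired `Cor24_i' Dec W C Ld (K_1 × 1)` is false — its first family member
`H := Π_{v▶} = ⊤` is `not_cor24_i_top_cusp_zero`. [claim: Mochizuki2012, status: disputed] (IUTchII §2 Cor 2.4 (i), kurims pp.69-70) -/
theorem exists_not_cor24_i' :
    ∃ (D : EtaleThetaData (dBadPlaceSetting l p hl hl2 hp hp2 hpl).toThetaSetting
        (dBadPlaceSetting l p hl hl2 hp hp2 hpl).PiX)
      (Dec : SubgraphDecomposition (dBadPlaceSetting l p hl hl2 hp hp2 hpl) (dCoverings l p hl hl2 hp hp2 hpl) D)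
      (L : LabCuspStructure (dCusps l p hl hl2 hp hp2 hpl)) (Ld : LabelledDecomposition Dec L),
      Dec.Ptri = ⊤ ∧ ¬ Cor24_i' Dec (dTower l p hl hl2 hp hp2 hpl) (dCusps l p hl hl2 hp hp2 hpl) Ld (cusp l 0) := by
  let D : EtaleThetaData (dBadPlaceSetting l p hl hl2 hp hp2 hpl).toThetaSetting
      (dBadPlaceSetting l p hl hl2 hp hp2 hpl).PiX :=
    degenerateEtaleThetaData _
  -- the subgraph decomposition `Π_{v•} = Π_{v▶} := ⊤`, `ι := id`, references `⊤`
  let Dec : SubgraphDecomposition (dBadPlaceSetting l p hl hl2 hp hp2 hpl) (dCoverings l p hl hl2 hp hp2 hpl) D :=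
    { Pbullet := ⊤
      Ptri := ⊤
      bullet_le_tri := le_rfl
      tri_le_YL := by
        intro x _
        exact Subgroup.mem_comap.mpr (Subgroup.mem_top _)
      iota := ContinuousMulEquiv.refl _
      iota_bullet := Subgroup.map_id ⊤
      iota_tri := Subgroup.map_id ⊤
      iota_Ydd := Subgroup.map_id _
      refTri := ⊤
      refBullet := ⊤
      corresponds := ⟨ContinuousMulEquiv.refl _, 1, by simp, by simp⟩ }
  obtain ⟨L⟩ := nonempty_labCuspStructure l p hl hl2 hp hp2 hpl
  obtain ⟨Ld⟩ := LabelledDecomposition.nonempty Dec L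
  refine ⟨D, Dec, L, Ld, rfl, fun h => ?_⟩
  exact not_cor24_i_top_cusp_zero l p hl hl2 hp hp2 hpl (h ⊤ (Or.inl rfl))

end DihedralCuspToy

/-- **F-2679 is a schema**: the universal closure of the repaired `Cor24_i'` (over all bad-place settings, tempered
coverings, étale-theta data, subgraph decompositions, `±`-towers, cuspidal-inertia predicates, label structures,
labelled decompositions and `I`) is FALSE — closed witness at `l := 3`, `p := 5` (the dihedral cusp toy).  The
instance forms the cone uses are the conditional closers at genuine data (`cor24_i'_of_inputs`,
`cor24_i'_of_inputs_inc`, `cor24_i'_of_graphLevels_byName`, … BY NAME).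
[claim: Mochizuki2012, status: disputed] (IUTchII §2 Cor 2.4 (i), kurims pp.69-70) -/
theorem not_forall_cor24_i' :
    ¬ ∀ (S : BadPlaceSetting.{0}) (P : TopGroup.{0}) (T : TemperedCoverings S P)
        (D : EtaleThetaData S.toThetaSetting P) (Dec : SubgraphDecomposition S T D) (W : PlusMinusTower T)
        (C : CuspidalInertiaData W) (L : LabCuspStructure C) (Ld : LabelledDecomposition Dec L)
        (I : Subgroup W.Corhat), Cor24_i' Dec W C Ld I := by
  intro h
  obtain ⟨D, Dec, L, Ld, -, hnot⟩ :=
    DihedralCuspToy.exists_not_cor24_i' 3 5 Nat.prime_three (by decide) Nat.prime_five (by decide) (by decide)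
  exact hnot (h _ _ _ D Dec _ _ L Ld _)

end Literature.IUT.HodgeArakelov

end
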